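import Literature.NumberTheory.Automorphic.BockleHuiIrreducibleGL3ReductionProofs
import Literature.NumberTheory.Automorphic.RamakrishnanMultiplicityOneLemma414
import Literature.NumberTheory.Automorphic.CuspidalContragredient
import Literature.NumberTheory.Automorphic.PairLFunctionPolesGLOneDedekindProofs
import Literature.NumberTheory.Automorphic.PairLFunctionPolesRepDataHolds
import HarnessLib

/-!
# Böckle–Hui 2025, Theorem 1.2 — the analytic case of §3.2.1 from Jacquet–Shalika, proved in the
# Borel–Jacquet model (`∏ α_v = μ(ϖ_v)³` a.e. for a Hecke character among the Satake eigenvalues)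

Topic `NumberTheory/Automorphic`; namespace `Literature.NumberTheory.Automorphic`.  Third PROOFS file
(theorems only: no definition, no named fact, no `sorry`) for the named fact
`isIrreducible_galoisRep_gl3_totallyReal` (Böckle–Hui, Math. Ann. 393 (2025), Thm. 1.2, arXiv
p. 13), after `BockleHuiIrreducibleGL3Proofs` (skeleton of §3.2.1) and
`BockleHuiIrreducibleGL3ReductionProofs` (reduction of `hrat`, `hL` to statements about `π` alone:
`hCar` and the analytic case `hB`).  This file PROVES the analytic case `hB` from named facts of the
tree — Jacquet–Shalika (2.2) for Borel–Jacquet data and the contragredient datum — plus a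
central character at Satake level and one explicit weight condition, by the printed `L`-function
argument, mapped onto the tree exactly as Ramakrishnan's Lemma 4.1.4 is in
`RamakrishnanMultiplicityOneLemma414` (whose multiset/Euler-product bookkeeping is reused).  Of
Arthur–Clozel's (2.1)–(2.3) the printed argument uses (2.1) (convergence; the theorem
`JacquetShalika1981_multipliable_partialPairL_repData_holds` of `PairLFunctionPolesRepDataHolds`),
(2.2) (the named fact `JacquetShalika1981_partialPairL_boundary_repData`) and, of (2.3), only the
simple pole of `L^{S'}(1, s) = ζ_F^{S'}(s)` at `s = 1` — Hecke's theorem, PROVED in the tree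
(`tendsto_sub_one_mul_tprod_eulerFactor_one_numberField` of `PairLFunctionPolesGLOneDedekindProofs`,
on Mathlib's class number formula residue); so the general (2.3) for Borel–Jacquet data
(`JacquetShalika1981_partialPairL_pole_repData`, whose discharge is the `GL_n × GL_n` theory of
Jacquet–Shalika II, Prop. 3.6) is **not** an input of this file.

Source (held arXiv text `paper:arxiv-2404.08954`, §3.2.1, p. 13):

> "`1 ⊕ (Alt²(ρ_λ) ⊗ τ_λ^{-2}) = (ρ_λ ⊗ τ_λ^{-1}) ⊕ (det(σ_λ)·τ_λ^{-2})`. … we obtain from (Alt) and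
> the local-global compatibility (lg) an equation on partial L-functions
> `L^{S'}(1, s) L^{S'}(Alt²(π) ⊗ ψ₁, s) = L^{S'}(π ⊗ ψ₂, s) L^{S'}(ψ₃, s)`, where `ψ₁, ψ₂, ψ₃` are
> some algebraic Hecke characters of `K` and `ψ₃` corresponds to the locally algebraic character
> `det(σ_λ)·τ_λ^{-2}`. Suppose `det(σ_λ)·τ_λ^{-2}` is non-trivial. On the one hand, the right-hand
> side of (L-eq) at `s = 1` belongs to `ℂ` by `ψ₃` non-trivial and `π` cuspidal. On the other hand,
> `L^{S'}(1, s)` has a simple pole at `s = 1` and `L^{S'}(Alt²(π) ⊗ ψ₁, s)` is non-zero at `s = 1` by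
> Shahidi [Sh97]. We get a contradiction."

## The rendering (Satake level, Borel–Jacquet data)

After `exists_algebraic_valueAtUniformizer_mem_satake_of_stableLine` (reduction file) the Galois
representation is gone: `π` is cuspidal on `GL_3(𝔸_F)` and `μ = χ‖·‖` is a Hecke character with
`μ(ϖ_v) ∈ α_v` a.e.; `τ_λ ↔ μ`, `det ρ_λ ↔ Ω` (central character at Satake level, `Ω(ϖ_v) = ∏ α_v`),
`ψ₃ ↔ Ω μ⁻³`, and "`ψ₃` trivial" reads `∏ α_v = μ(ϖ_v)³` a.e.

* *Unitarity.* Jacquet–Shalika (2.1)–(2.2) are vendored for UNITARY Satake families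
  (`|det t_w| = 1`).  With `|μ| = ‖·‖^σ` (`HeckeCharacter.exists_norm_apply_eq_ideleNorm_rpow`) and
  `λ = ‖·‖^{-σ}` (`exists_heckeCharacter_ideleNorm_cpow`), `θ = λμ` is unitary and `π₀ = π ⊗ λ`
  (`CuspidalAutomorphicRepData.exists_twist_hecke_hasSatakeParamAt`) has Satake family
  `β_w = λ(ϖ_w) α_w ∋ θ(ϖ_w)`; it is unitary iff `‖∏ α_w‖ = ‖μ(ϖ_w)‖³` — the **weight condition**
  `hpin`, an explicit hypothesis here (in BH's setting it is the purity bookkeeping implicit in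
  "non-zero at `s = 1`": Clozel's purity lemma, `K` totally real and `n = 3` odd force the motivic
  weight to be even, and an algebraic Hecke character of a totally real field has parallel integral
  weight; none of this is in the tree).
* *`Alt²` on `GL_3` is a twist of the contragredient*: `Alt²(t) = (det t) t⁻¹`, so no exterior-square
  functoriality and no [Sh97] are needed — only the contragredient datum
  (`CuspidalAutomorphicRepData.exists_contragredient_satake`, named fact) and Jacquet–Shalika's own
  non-vanishing (2.2).  With `β_w = {θ, b, c}`, `κ = bc/θ = Ω λ³ θ⁻²`, `ν = bc/θ² = Ω λ³ θ⁻³ = Ω μ⁻³ ↔ ψ₃`: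
  `det(1 - β θ⁻¹ T) (1 - ν T) = (1 - T) det(1 - κ β⁻¹ T)` (`satakePairPolynomial_bh_identity`; both
  sides `(1 - T)(1 - (b/θ)T)(1 - (c/θ)T)(1 - ν T)`), i.e. (L-eq) factor by factor:
  `L^S(s, π₀ × θ⁻¹) · L^S(s, ν) = ζ_F^S(s) · L^S(s, π₀^∨ ⊗ κ)`.
* *The poles* (`eventually_eq_one_of_JS_of_eulerIdentity`): if `ν(ϖ_w) ≠ 1` infinitely often (the
  `X`-condition fails), (2.2) gives finite limits `L^S(s, π₀ × θ⁻¹) → c₁` (`3 ≠ 1`) and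
  `L^S(s, ν) → c₃` as `s → 1⁺`, while `(s - 1) ζ_F^S(s) → c₀ ≠ 0` ((2.3) for the trivial
  character: Hecke's theorem, `tendsto_sub_one_mul_partialPairL_one_one`) and (2.2) gives
  `L^S(s, π₀^∨ ⊗ κ) → c₂ ≠ 0`: multiplying (L-eq) by `s - 1`, `0 = c₀ c₂`, contradiction.  Hence
  `ν(ϖ_w) = 1` a.e., i.e. `∏ α_w = μ(ϖ_w)³` a.e. (`prod_satake_eq_cube_of_JS`).

## Main statements

* `tendsto_sub_one_mul_partialPairL_one_one` — `L^S(s, 𝟙 × 𝟙) = ζ_F^S(s)` has a simple pole at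
  `s = 1` (the only instance of (2.3) used; a theorem).
* `prod_satake_eq_cube_of_JS` — the analytic case for one `π`, from (2.2) (`hJ2`), the
  contragredient, `Ω` and the weight condition.
* `satakeLevel_analyticCase_of_JS` — the hypothesis `hB` of
  `lDichotomy_gl3_totallyReal_of_satakeLevel` /
  `isIrreducible_galoisRep_gl3_totallyReal_of_weaklyDivides_of_arithmetic_of_satakeLevel_of_hui`.
* `centralCharacter_satake_gl3_of_leaves` — `hcent` from the Borel–Jacquet dictionary leaves.
* `isIrreducible_galoisRep_gl3_totallyReal_of_JS` — **what now separates
  `isIrreducible_galoisRep_gl3_totallyReal_holds` from the tree**: the named facts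
  `exists_heckeCharacter_of_weaklyDivides` (BH Thm. 1.1), `JacquetShalika1981_partialPairL_boundary_repData`
  ((2.2)), `exists_contragredient_satake`, the dictionary leaves; and three printed inputs without
  carrier: C-arithmeticity (`hCar`), the weight condition (`hpin`), [Hu23a] (`hHui`).

## References

* G. Böckle, C.-Y. Hui, *Weak abelian direct summands and irreducibility of Galois
  representations*, Math. Ann. 393 (2025) 543–569, §3.2.1 (arXiv p. 13). [BockleHui2025]
* J. Arthur, L. Clozel, *Simple algebras, base change, and the advanced theory of the trace
  formula*, Ann. of Math. Stud. 120 (1989), Ch. 3 §2, (2.1)–(2.3), p. 171. [ArthurClozelAMS120]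
* H. Jacquet, J. A. Shalika, *On Euler products and the classification of automorphic forms I, II*,
  Amer. J. Math. 103 (1981). [JacquetShalikaAJM1981] [JacquetShalikaAJM1981II]
* A. Borel, H. Jacquet, *Automorphic forms and automorphic representations*, PSPM 33.1 (1979), §4.6,
  5.7. [BorelJacquetCorvallis1979]
* D. Ramakrishnan, Ann. of Math. 152 (2000), Lemma 4.1.4 (the template of the pole count).
  [Ramakrishnan2000]
* J. Neukirch, *Algebraic Number Theory*, Grundlehren 322 (1999), Ch. VII, Cor. (5.11) (ii) (the pole
  of `ζ_F` at `s = 1`, Hecke 1917). [NeukirchANT1999]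
-/

noncomputable section

open scoped MatrixGroups Topology Classical NumberField
open NumberField IsDedekindDomain MeasureTheory Filter Polynomial

namespace Literature.NumberTheory.Automorphic

open AdelicGroupData
open Literature.NumberTheory.GaloisRepresentations (HeckeCharacter ideleGroup localUnits)

section Bookkeeping

variable {F : Type} [Field F] [NumberField F]

/-- `χ(ϖ_v)` is the value of `χ` at the idele `(…, 1, ϖ_v, 1, …)`. [folklore] -/
private theorem bh_vAU_apply (χ : HeckeCharacter F) (v : HeightOneSpectrum (𝓞 F)) :
    χ.valueAtUniformizer v =
      ((χ (localUnits v (GaloisRepresentations.HeckeCharacter.uniformizer F v)) : ℂˣ) : ℂ) := by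
  simp only [GaloisRepresentations.HeckeCharacter.valueAtUniformizer,
    GaloisRepresentations.HeckeCharacter.localComponent_apply]

/-- `(χ₁ χ₂)(ϖ_v) = χ₁(ϖ_v) χ₂(ϖ_v)`. [folklore] -/
private theorem bh_vAU_mul (χ₁ χ₂ : HeckeCharacter F) (v : HeightOneSpectrum (𝓞 F)) :
    (χ₁ * χ₂).valueAtUniformizer v = χ₁.valueAtUniformizer v * χ₂.valueAtUniformizer v := by
  simp only [bh_vAU_apply, GaloisRepresentations.HeckeCharacter.mul_apply, Units.val_mul]

/-- `χ⁻¹(ϖ_v) = χ(ϖ_v)⁻¹`. [folklore] -/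
private theorem bh_vAU_inv (χ : HeckeCharacter F) (v : HeightOneSpectrum (𝓞 F)) :
    χ⁻¹.valueAtUniformizer v = (χ.valueAtUniformizer v)⁻¹ := by
  simp only [bh_vAU_apply, GaloisRepresentations.HeckeCharacter.inv_apply, Units.val_inv_eq_inv_val]

/-- `(χ ^ n)(ϖ_v) = χ(ϖ_v) ^ n`. [folklore] -/
private theorem bh_vAU_pow (χ : HeckeCharacter F) (n : ℕ) (v : HeightOneSpectrum (𝓞 F)) :
    (χ ^ n).valueAtUniformizer v = χ.valueAtUniformizer v ^ n := by
  simp only [bh_vAU_apply, GaloisRepresentations.HeckeCharacter.pow_apply, Units.val_pow_eq_pow_val]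

/-- `χ(ϖ_v) ≠ 0`. [folklore] -/
private theorem bh_vAU_ne_zero (χ : HeckeCharacter F) (v : HeightOneSpectrum (𝓞 F)) :
    χ.valueAtUniformizer v ≠ 0 := by
  rw [bh_vAU_apply]
  exact Units.ne_zero _

/-- **A Hecke character as a cuspidal datum on `GL(1)`** with Satake parameter `{θ(ϖ_w)}` at almost
every place: the line `ℂ · (θ ∘ det)` over `⊥` (`exists_automorphicRepData_detTwist_glOne`; on
`GL(1)` every automorphic form is a cusp form, the parabolic condition being empty), with the
Satake parameters of `AutomorphicRepData.hasSatakeParamAt_detTwist_glOne` off a level of `θ`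
(`HeckeCharacter.exists_level_glOne`).  Borel–Jacquet 1979, 4.6 (automorphic representations of
`GL(1)` = idèle class characters). [cite: BorelJacquet1979, 4.6] -/
theorem exists_cuspidal_glOne_hasSatakeParamAt_valueAtUniformizer
    (h1 : isCompact_glFiniteIntegralLevel 1 F) (θ : HeckeCharacter F) :
    ∃ τ : CuspidalAutomorphicRepData 1 F h1,
      ∀ᶠ w : HeightOneSpectrum (𝓞 F) in cofinite, τ.1.HasSatakeParamAt w {θ.valueAtUniformizer w} := by
  obtain ⟨τ, hW, hW'⟩ := exists_automorphicRepData_detTwist_glOne h1 θ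
  have hcusp : τ.W ≤ cuspFormsGL 1 F h1 := by
    rw [hW, Submodule.span_le]
    rintro _ rfl
    exact IsCuspFormGL.mem_cuspFormsGL
      ⟨isAutomorphicForm_detTwist_glOne h1 θ, fun k hk hk1 => absurd hk1 (by omega)⟩
  refine ⟨⟨τ, hcusp⟩, ?_⟩
  obtain ⟨𝔪, h𝔪, hθ𝔪⟩ :=
    Literature.NumberTheory.GaloisRepresentations.HeckeCharacter.exists_level_glOne θ
  filter_upwards [(Ideal.finite_factors h𝔪).compl_mem_cofinite] with w hw
  have h := AutomorphicRepData.hasSatakeParamAt_detTwist_glOne h1 hW hW' h𝔪 hθ𝔪 w hw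
    (Literature.NumberTheory.GaloisRepresentations.HeckeCharacter.valued_uniformizer (K := F) w)
  rwa [← bh_vAU_apply] at h

end Bookkeeping

/-! ### The Euler-factor identity of BH §3.2.1 for `n = 3` -/

section Algebra

/-- **(L-eq) factor by factor, for `n = 3` without `Alt²`.**  For `t = {θ, b, c}` (`θ b c ≠ 0`),
`κ = b c / θ` and `ν = b c / θ²`:
`det(1 - t θ⁻¹ T) · (1 - ν T) = (1 - T) · det(1 - κ t⁻¹ T)`, both sides being
`(1 - T)(1 - (b/θ) T)(1 - (c/θ) T)(1 - ν T)` — the unramified Euler factors of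
`L(ρ_λ ⊗ τ_λ⁻¹, s) L(ψ₃, s) = L(1, s) L(Alt²(ρ_λ) ⊗ τ_λ^{-2}, s)` (the third line of (Alt) in BH
§3.2.1), with `Alt² t = (det t) t⁻¹` on `GL_3`, so that `Alt²(t) θ⁻² = κ t⁻¹`.
[cite: BockleHui2025, §3.2.1] -/
theorem satakePairPolynomial_bh_identity {θ b c : ℂ} (hθ : θ ≠ 0) (hb : b ≠ 0) (hc : c ≠ 0) :
    satakePairPolynomial (θ ::ₘ {b, c}) {θ⁻¹} * satakePairPolynomial {θ⁻¹ * (b * c) * θ⁻¹} {1} =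
      satakePairPolynomial {1} {1} *
        satakePairPolynomial (((θ ::ₘ {b, c}).map (·⁻¹)).map (θ⁻¹ * (b * c) * ·)) {1} := by
  have e1 : θ⁻¹ * (b * c) * b⁻¹ = c * θ⁻¹ := by field_simp
  have e2 : θ⁻¹ * (b * c) * c⁻¹ = b * θ⁻¹ := by field_simp
  have e3 : θ * θ⁻¹ = 1 := mul_inv_cancel₀ hθ
  simp only [satakePairPolynomial_eq_eulerPolynomial, satakeTensor_comm _ {θ⁻¹},
    satakeTensor_comm _ ({1} : Multiset ℂ), satakeTensor_singleton_left, Multiset.insert_eq_cons,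
    Multiset.map_cons, Multiset.map_singleton, eulerPolynomial_cons, one_mul]
  rw [mul_comm θ⁻¹ θ, e3, e1, e2, mul_comm θ⁻¹ b, mul_comm θ⁻¹ c]
  simp only [eulerPolynomial, Multiset.map_singleton, Multiset.prod_singleton]
  ring

end Algebra

section Analytic

variable {K : Type} [Field K] [NumberField K]

/-- **An identity of pairs of partial `L`-functions from an identity of Euler factors.**  If off `S`
`P(p, q) P(p', q') = P(a, b) P(a', b')` for the Rankin–Selberg polynomials and the four Euler
products are multipliable at `s`, then
`L^S(s, p ⊗ q) L^S(s, p' ⊗ q') = L^S(s, a ⊗ b) L^S(s, a' ⊗ b')`. [folklore] -/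
theorem partialPairL_mul_eq_of_satakePairPolynomial_mul_eq {S : Set (HeightOneSpectrum (𝓞 K))}
    {p q p' q' a b a' b' : SatakeFamily K}
    (hId : ∀ v ∉ S, satakePairPolynomial (p v) (q v) * satakePairPolynomial (p' v) (q' v) =
      satakePairPolynomial (a v) (b v) * satakePairPolynomial (a' v) (b' v))
    {s : ℂ}
    (hpq : Multipliable fun v : {v : HeightOneSpectrum (𝓞 K) // v ∉ S} =>
      ((satakePairPolynomial (p v.1) (q v.1)).eval ((v.1.residueCard : ℂ) ^ (-s)))⁻¹)
    (hpq' : Multipliable fun v : {v : HeightOneSpectrum (𝓞 K) // v ∉ S} =>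
      ((satakePairPolynomial (p' v.1) (q' v.1)).eval ((v.1.residueCard : ℂ) ^ (-s)))⁻¹)
    (hab : Multipliable fun v : {v : HeightOneSpectrum (𝓞 K) // v ∉ S} =>
      ((satakePairPolynomial (a v.1) (b v.1)).eval ((v.1.residueCard : ℂ) ^ (-s)))⁻¹)
    (hab' : Multipliable fun v : {v : HeightOneSpectrum (𝓞 K) // v ∉ S} =>
      ((satakePairPolynomial (a' v.1) (b' v.1)).eval ((v.1.residueCard : ℂ) ^ (-s)))⁻¹) :
    partialPairL S p q s * partialPairL S p' q' s = partialPairL S a b s * partialPairL S a' b' s := by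
  unfold partialPairL
  rw [← hpq.tprod_mul hpq', ← hab.tprod_mul hab']
  congr 1
  funext v
  rw [← mul_inv, ← mul_inv, ← eval_mul, ← eval_mul, hId v.1 v.2]

/-- **Pole bookkeeping of BH §3.2.1.**  Along a non-trivial filter `l` with `s - 1 → 0`: if
`F₁ · Lν = Z · F₂` eventually, `F₁ → c₁`, `Lν → c₃` (finite), `(s - 1) Z → c₀ ≠ 0` and
`F₂ → c₂ ≠ 0`, contradiction — "the right-hand side of (L-eq) at `s = 1` belongs to `ℂ` … On the
other hand, `L^{S'}(1, s)` has a simple pole at `s = 1` and [the other factor] is non-zero at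
`s = 1` … We get a contradiction." [cite: BockleHui2025, §3.2.1] -/
theorem false_of_pole_times_nonzero_eq_finite {l : Filter ℂ} [l.NeBot] {F₁ Lν Z F₂ : ℂ → ℂ}
    {c₀ c₁ c₂ c₃ : ℂ} (hsub : Tendsto (fun s => s - 1) l (𝓝 0))
    (hEq : ∀ᶠ s in l, F₁ s * Lν s = Z s * F₂ s)
    (hF₁ : Tendsto F₁ l (𝓝 c₁)) (hLν : Tendsto Lν l (𝓝 c₃))
    (hZ : Tendsto (fun s => (s - 1) * Z s) l (𝓝 c₀)) (hc₀ : c₀ ≠ 0)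
    (hF₂ : Tendsto F₂ l (𝓝 c₂)) (hc₂ : c₂ ≠ 0) : False := by
  have h1 : Tendsto (fun s => (s - 1) * (F₁ s * Lν s)) l (𝓝 (0 * (c₁ * c₃))) :=
    hsub.mul (hF₁.mul hLν)
  have h2 : Tendsto (fun s => (s - 1) * Z s * F₂ s) l (𝓝 (c₀ * c₂)) := hZ.mul hF₂
  have heq : (fun s => (s - 1) * Z s * F₂ s) =ᶠ[l] fun s => (s - 1) * (F₁ s * Lν s) :=
    hEq.mono fun s hs => by simp only [hs]; ring
  rw [zero_mul] at h1
  exact mul_ne_zero hc₀ hc₂ (tendsto_nhds_unique (h2.congr' heq) h1)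

/-- **`L^S(s, 𝟙 × 𝟙) = ζ_F^S(s)`**: for the Satake family `one ≡ {1}` of the trivial character the
Rankin–Selberg Euler factor is `det(1 - 1 ⊗ 1 · q_v^{-s}) = 1 - q_v^{-s}`, so `partialPairL S one one`
is the partial Dedekind zeta function `∏'_{v ∉ S} (1 - q_v^{-s})⁻¹`. [folklore] -/
theorem partialPairL_one_one {S : Set (HeightOneSpectrum (𝓞 K))} {one : SatakeFamily K}
    (hone : ∀ w, one w = {1}) (s : ℂ) :
    partialPairL S one one s =
      ∏' v : {v : HeightOneSpectrum (𝓞 K) // v ∉ S}, (1 - ((v.1.residueCard : ℂ) ^ (-s)))⁻¹ := by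
  simp only [partialPairL, hone, satakePairPolynomial_eq_eulerPolynomial, satakeTensor_singleton_left,
    Multiset.map_singleton, eval_eulerPolynomial, Multiset.prod_singleton, one_mul]

/-- **Arthur–Clozel (2.3) for the pair of trivial characters is Hecke's theorem**: `ζ_F^S(s) =
L^S(s, 𝟙 × 𝟙)` has a simple pole at `s = 1`, `(s - 1) L^S(s, 𝟙 × 𝟙) → c₀ ≠ 0` as `s → 1`, `Re s > 1`
(`c₀ = res_{s=1} ζ_F · ∏_{v ∈ S} (1 - q_v^{-1})`; the tree's
`tendsto_sub_one_mul_tprod_eulerFactor_one_numberField`, on Mathlib's `NumberField.dedekindZeta_residue_pos`).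
This is the only instance of (2.3) in BH §3.2.1 ("`L^{S'}(1, s)` has a simple pole at `s = 1`").
[cite: NeukirchANT1999, Ch. VII Cor. (5.11) (ii)] [cite: ArthurClozelAMS120, Ch. 3 §2 (2.3)] -/
theorem tendsto_sub_one_mul_partialPairL_one_one {S : Set (HeightOneSpectrum (𝓞 K))} (hS : S.Finite)
    {one : SatakeFamily K} (hone : ∀ w, one w = {1}) :
    ∃ c : ℂ, c ≠ 0 ∧
      Tendsto (fun s => (s - 1) * partialPairL S one one s) (𝓝[{s : ℂ | 1 < s.re}] 1) (𝓝 c) := by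
  simp only [partialPairL_one_one hone]
  exact tendsto_sub_one_mul_tprod_eulerFactor_one_numberField hS

/-- **The analytic core of BH §3.2.1 in the Borel–Jacquet model.**  Granting Jacquet–Shalika
(2.2) for Borel–Jacquet data (`JacquetShalika1981_partialPairL_boundary_repData`; (2.1) is the theorem
`JacquetShalika1981_multipliable_partialPairL_repData_holds`): let `τ₀`, `τ₁`, `τν` be
cuspidal data on `GL(1)` and `P`, `Q` on `GL(3)` over `F` whose Satake families off a finite `T`
are `{1}`, `t₁`, `tν`, `β`, `B`, all unitary (`|det t_w| = 1`), and suppose the Euler factors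
satisfy `P(β, t₁) P(tν, 1) = P(1, 1) P(B, 1)` off `T` (the identity (L-eq):
`L^S(s, P × τ₁) L^S(s, τν) = ζ_F^S(s) L^S(s, Q)`).  Then `tν_w = {1}` for almost all `w` (the
character `τν` is in the pole case `X` of (2.2)–(2.3)): otherwise `L^S(s, τν) → c₃` and
`L^S(s, P × τ₁) → c₁` (finite, (2.2) with `3 ≠ 1`), while `(s - 1) ζ_F^S(s) → c₀ ≠ 0` (Hecke;
`tendsto_sub_one_mul_partialPairL_one_one`) and `L^S(s, Q) → c₂ ≠ 0` ((2.2)), so that `(s - 1) ×` (L-eq)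
tends both to `0` and to `c₀ c₂ ≠ 0`.
[cite: BockleHui2025, §3.2.1] [cite: ArthurClozelAMS120, Ch. 3 §2 (2.1)–(2.3)] -/
theorem eventually_eq_one_of_JS_of_eulerIdentity {F : Type} [Field F] [NumberField F]
    (hJ2 : JacquetShalika1981_partialPairL_boundary_repData)
    {h1 : isCompact_glFiniteIntegralLevel 1 F} {h3 : isCompact_glFiniteIntegralLevel 3 F}
    (τ₀ τ₁ τν : CuspidalAutomorphicRepData 1 F h1) (P Q : CuspidalAutomorphicRepData 3 F h3)
    (one t₁ tν β B : SatakeFamily F) {T : Set (HeightOneSpectrum (𝓞 F))} (hT : T.Finite)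
    (hone : ∀ w, one w = {1})
    (hτ₀ : ∀ w ∉ T, τ₀.1.HasSatakeParamAt w (one w)) (hτ₁ : ∀ w ∉ T, τ₁.1.HasSatakeParamAt w (t₁ w))
    (hτν : ∀ w ∉ T, τν.1.HasSatakeParamAt w (tν w))
    (hP : ∀ w ∉ T, P.1.HasSatakeParamAt w (β w)) (hQ : ∀ w ∉ T, Q.1.HasSatakeParamAt w (B w))
    (hu₁ : ∀ w ∉ T, ‖(t₁ w).prod‖ = 1) (huν : ∀ w ∉ T, ‖(tν w).prod‖ = 1)
    (huβ : ∀ w ∉ T, ‖(β w).prod‖ = 1) (huB : ∀ w ∉ T, ‖(B w).prod‖ = 1)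
    (hId : ∀ w ∉ T, satakePairPolynomial (β w) (t₁ w) * satakePairPolynomial (tν w) (one w) =
      satakePairPolynomial (one w) (one w) * satakePairPolynomial (B w) (one w)) :
    ∀ᶠ w : HeightOneSpectrum (𝓞 F) in cofinite,
      (tν w).map ((((w.residueCard : ℂ)) ^ ((1 : ℂ) - 1)) * ·) = (one w).map (·⁻¹) := by
  by_contra hX
  -- the exceptional sets of the seven instances of (2.1)–(2.2) ((2.1) is a theorem)
  have hJ1 := JacquetShalika1981_multipliable_partialPairL_repData_holds
  obtain ⟨S₁, hS₁, hJ1a⟩ := hJ1 3 1 F h3 h1 (by norm_num) one_pos P τ₁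
  obtain ⟨S₂, hS₂, hJ1b⟩ := hJ1 1 1 F h1 h1 one_pos one_pos τν τ₀
  obtain ⟨S₃, hS₃, hJ1c⟩ := hJ1 1 1 F h1 h1 one_pos one_pos τ₀ τ₀
  obtain ⟨S₄, hS₄, hJ1d⟩ := hJ1 3 1 F h3 h1 (by norm_num) one_pos Q τ₀
  obtain ⟨S₅, hS₅, hJ2a⟩ := hJ2 3 1 F h3 h1 (by norm_num) one_pos P τ₁
  obtain ⟨S₆, hS₆, hJ2b⟩ := hJ2 1 1 F h1 h1 one_pos one_pos τν τ₀
  obtain ⟨S₇, hS₇, hJ2c⟩ := hJ2 3 1 F h3 h1 (by norm_num) one_pos Q τ₀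
  set S : Set (HeightOneSpectrum (𝓞 F)) := T ∪ S₁ ∪ S₂ ∪ S₃ ∪ S₄ ∪ S₅ ∪ S₆ ∪ S₇ with hS_def
  have hS : S.Finite :=
    ((((((hT.union hS₁).union hS₂).union hS₃).union hS₄).union hS₅).union hS₆).union hS₇
  have hTS : ∀ w ∉ S, w ∉ T := fun w hw hwT => hw (by simp [hS_def, hwT])
  have sub₁ : S₁ ⊆ S := fun x hx => by simp [hS_def, hx]
  have sub₂ : S₂ ⊆ S := fun x hx => by simp [hS_def, hx]
  have sub₃ : S₃ ⊆ S := fun x hx => by simp [hS_def, hx]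
  have sub₄ : S₄ ⊆ S := fun x hx => by simp [hS_def, hx]
  have sub₅ : S₅ ⊆ S := fun x hx => by simp [hS_def, hx]
  have sub₆ : S₆ ⊆ S := fun x hx => by simp [hS_def, hx]
  have sub₇ : S₇ ⊆ S := fun x hx => by simp [hS_def, hx]
  -- the hypotheses off `S`
  have hτ₀S : ∀ w ∉ S, τ₀.1.HasSatakeParamAt w (one w) := fun w hw => hτ₀ w (hTS w hw)
  have hτ₁S : ∀ w ∉ S, τ₁.1.HasSatakeParamAt w (t₁ w) := fun w hw => hτ₁ w (hTS w hw)
  have hτνS : ∀ w ∉ S, τν.1.HasSatakeParamAt w (tν w) := fun w hw => hτν w (hTS w hw)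
  have hPS : ∀ w ∉ S, P.1.HasSatakeParamAt w (β w) := fun w hw => hP w (hTS w hw)
  have hQS : ∀ w ∉ S, Q.1.HasSatakeParamAt w (B w) := fun w hw => hQ w (hTS w hw)
  have huone : ∀ w ∉ S, ‖(one w).prod‖ = 1 := fun w _ => by rw [hone]; simp
  have hu₁S : ∀ w ∉ S, ‖(t₁ w).prod‖ = 1 := fun w hw => hu₁ w (hTS w hw)
  have huνS : ∀ w ∉ S, ‖(tν w).prod‖ = 1 := fun w hw => huν w (hTS w hw)
  have huβS : ∀ w ∉ S, ‖(β w).prod‖ = 1 := fun w hw => huβ w (hTS w hw)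
  have huBS : ∀ w ∉ S, ‖(B w).prod‖ = 1 := fun w hw => huB w (hTS w hw)
  -- (2.1): multipliability on `Re s > 1`
  have mP1 : ∀ s : ℂ, 1 < s.re → Multipliable fun v : {v : HeightOneSpectrum (𝓞 F) // v ∉ S} =>
      ((satakePairPolynomial (β v.1) (t₁ v.1)).eval ((v.1.residueCard : ℂ) ^ (-s)))⁻¹ :=
    fun s hs => hJ1a hS sub₁ hPS hτ₁S huβS hu₁S hs
  have mν1 : ∀ s : ℂ, 1 < s.re → Multipliable fun v : {v : HeightOneSpectrum (𝓞 F) // v ∉ S} =>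
      ((satakePairPolynomial (tν v.1) (one v.1)).eval ((v.1.residueCard : ℂ) ^ (-s)))⁻¹ :=
    fun s hs => hJ1b hS sub₂ hτνS hτ₀S huνS huone hs
  have m11 : ∀ s : ℂ, 1 < s.re → Multipliable fun v : {v : HeightOneSpectrum (𝓞 F) // v ∉ S} =>
      ((satakePairPolynomial (one v.1) (one v.1)).eval ((v.1.residueCard : ℂ) ^ (-s)))⁻¹ :=
    fun s hs => hJ1c hS sub₃ hτ₀S hτ₀S huone huone hs
  have mQ1 : ∀ s : ℂ, 1 < s.re → Multipliable fun v : {v : HeightOneSpectrum (𝓞 F) // v ∉ S} =>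
      ((satakePairPolynomial (B v.1) (one v.1)).eval ((v.1.residueCard : ℂ) ^ (-s)))⁻¹ :=
    fun s hs => hJ1d hS sub₄ hQS hτ₀S huBS huone hs
  -- (2.2) for `(P, τ₁)`: `L^S(s, P × τ₁) → c₁` (`3 ≠ 1`, so `X = ∅`)
  obtain ⟨c₁, -, hF₁⟩ := hJ2a hS sub₅ hPS hτ₁S huβS hu₁S Complex.one_re
    (fun h => absurd h.1 (by norm_num))
  -- (2.2) for `(τν, τ₀)` outside `X`: `L^S(s, τν) → c₃`
  obtain ⟨c₃, -, hLν⟩ := hJ2b hS sub₆ hτνS hτ₀S huνS huone Complex.one_re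
    (fun h => hX h.2)
  -- (2.3) for `(τ₀, τ₀)` — Hecke's theorem: `(s - 1) ζ_F^S(s) → c₀ ≠ 0`
  obtain ⟨c₀, hc₀, hZ⟩ := tendsto_sub_one_mul_partialPairL_one_one hS hone
  -- (2.2) for `(Q, τ₀)`: `L^S(s, Q) → c₂ ≠ 0`
  obtain ⟨c₂, hc₂, hF₂⟩ := hJ2c hS sub₇ hQS hτ₀S huBS huone Complex.one_re
    (fun h => absurd h.1 (by norm_num))
  -- (L-eq) on `Re s > 1` and the contradiction
  refine false_of_pole_times_nonzero_eq_finite (l := 𝓝[{s : ℂ | 1 < s.re}] 1)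
    tendsto_sub_one_nhdsWithin_one_lt_re ?_ hF₁ hLν hZ hc₀ hF₂ hc₂
  refine eventually_nhdsWithin_of_forall fun s hs => ?_
  exact partialPairL_mul_eq_of_satakePairPolynomial_mul_eq (fun v hv => hId v (hTS v hv))
    (mP1 s hs) (mν1 s hs) (m11 s hs) (mQ1 s hs)

end Analytic


section Construction

variable {F : Type} [Field F] [NumberField F]

/-- A Satake family of `π` (choice of a Satake parameter at every unramified place). [folklore] -/
private theorem exists_satakeFamily_of {n : ℕ} {h : isCompact_glFiniteIntegralLevel n F}
    (π : AutomorphicRepData (AutomorphyDatum.gl n F h)) :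
    ∃ f : SatakeFamily F, ∀ᶠ w : HeightOneSpectrum (𝓞 F) in cofinite, π.HasSatakeParamAt w (f w) :=
  ⟨fun w => if hw : π.IsUnramifiedAt w then hw.choose else 0, by
    filter_upwards [π.hasSatakeParamAt_cofinite_holds] with w hw
    rw [dif_pos hw]
    exact hw.choose_spec⟩

/-- **BH §3.2.1, the analytic case, from Jacquet–Shalika (2.2) and the contragredient, at
Satake level.**  Let `π` be a cuspidal automorphic representation of `GL_3(𝔸_F)` with central
character `Ω` at Satake level (`Ω(ϖ_v) = ∏ α_v` a.e.), and `μ` a Hecke character with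
`μ(ϖ_v) ∈ α_v` at almost every `v` (the automorphic shadow of `ρ_λ = σ_λ ⊕ τ_λ`,
`exists_algebraic_valueAtUniformizer_mem_satake_of_stableLine`).  Assume the weight condition
`‖∏ α_v‖ = ‖μ(ϖ_v)‖³` a.e. (`hpin`: after the unitary normalisation `π₀ = π ⊗ ‖·‖^{-σ}`,
`θ = μ‖·‖^{-σ}` with `|μ| = ‖·‖^σ`, both `π₀` and `θ` are unitary; this is where `s = 1` sits at
the edge of the critical strip).  Then `∏ α_v = μ(ϖ_v)³` at almost every `v` — i.e. the character
`ψ₃ ↔ Ω μ⁻³` of the printed proof is trivial: granting (2.2) for Borel–Jacquet data ((2.1) and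
the pole of `ζ_F^S` being theorems) and the contragredient datum
(`CuspidalAutomorphicRepData.exists_contragredient_satake`), the data
`τ₀ = 𝟙`, `τ₁ = θ⁻¹`, `τν = ν = Ω‖·‖^{-3σ}θ⁻³`, `P = π₀`, `Q = π₀^∨ ⊗ κ` (`κ = Ω‖·‖^{-3σ}θ⁻²`;
for `n = 3`, `Alt²(π₀) = π₀^∨ ⊗ ω_{π₀}`) satisfy the Euler-factor identity
`L^S(s, π₀ × θ⁻¹) L^S(s, ν) = ζ_F^S(s) L^S(s, π₀^∨ ⊗ κ)` (`satakePairPolynomial_bh_identity`), and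
`eventually_eq_one_of_JS_of_eulerIdentity` gives `ν(ϖ_w) = 1` a.e.  In print: "Suppose
`det(σ_λ)·τ_λ^{-2}` is non-trivial. On the one hand, the right-hand side of (L-eq) at `s = 1`
belongs to `ℂ` by `ψ₃` non-trivial and `π` cuspidal. On the other hand, `L^{S'}(1, s)` has a simple
pole at `s = 1` and `L^{S'}(Alt²(π) ⊗ ψ₁, s)` is non-zero at `s = 1` by Shahidi [Sh97]. We get a
contradiction." (Here Jacquet–Shalika's non-vanishing (2.2) replaces [Sh97], `Alt²` of `GL_3` being a
twist of the contragredient.) [cite: BockleHui2025, §3.2.1]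
[cite: ArthurClozelAMS120, Ch. 3 §2 (2.1)–(2.3)] -/
theorem prod_satake_eq_cube_of_JS
    (hJ2 : JacquetShalika1981_partialPairL_boundary_repData)
    {h3 : isCompact_glFiniteIntegralLevel 3 F}
    (hC : CuspidalAutomorphicRepData.exists_contragredient_satake h3)
    (π : CuspidalAutomorphicRepData 3 F h3) {Ω μ : HeckeCharacter F}
    (hΩ : ∀ᶠ v : HeightOneSpectrum (𝓞 F) in cofinite, ∀ α : Multiset ℂ,
      π.1.HasSatakeParamAt v α → Ω.valueAtUniformizer v = α.prod)
    (hμ : ∀ᶠ v : HeightOneSpectrum (𝓞 F) in cofinite, ∀ α : Multiset ℂ,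
      π.1.HasSatakeParamAt v α → μ.valueAtUniformizer v ∈ α)
    (hpin : ∀ᶠ v : HeightOneSpectrum (𝓞 F) in cofinite, ∀ α : Multiset ℂ,
      π.1.HasSatakeParamAt v α → ‖α.prod‖ = ‖μ.valueAtUniformizer v‖ ^ 3) :
    ∀ᶠ v : HeightOneSpectrum (𝓞 F) in cofinite, ∀ α : Multiset ℂ,
      π.1.HasSatakeParamAt v α → α.prod = μ.valueAtUniformizer v ^ 3 := by
  have h1 : isCompact_glFiniteIntegralLevel 1 F := isCompact_glFiniteIntegralLevel_holds 1 F
  -- the unitary normalisation: `|μ| = ‖·‖^σ`, `lam = ‖·‖^{-σ}`, `θ = lam μ` unitary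
  obtain ⟨σ, hσ⟩ := μ.exists_norm_apply_eq_ideleNorm_rpow
  obtain ⟨lam, hlam⟩ := exists_heckeCharacter_ideleNorm_cpow F ((-σ : ℝ) : ℂ)
  have hθu : ∀ x : ideleGroup F, ‖((lam x : ℂˣ) : ℂ)‖ * ‖((μ x : ℂˣ) : ℂ)‖ = 1 := by
    intro x
    have hN : (0 : ℝ) < GaloisRepresentations.ideleNorm x := by
      rw [← coe_ideleNorm]
      exact NNReal.coe_pos.2 (pos_iff_ne_zero.2 (ideleNorm_ne_zero _))
    rw [hlam x, Complex.norm_cpow_eq_rpow_re_of_pos hN, Complex.ofReal_re, hσ x,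
      ← Real.rpow_add hN, neg_add_cancel, Real.rpow_zero]
  set θ : HeckeCharacter F := lam * μ with hθdef
  have hθ1 : ∀ w : HeightOneSpectrum (𝓞 F), ‖θ.valueAtUniformizer w‖ = 1 := fun w => by
    rw [hθdef, bh_vAU_mul, norm_mul, bh_vAU_apply, bh_vAU_apply]
    exact hθu _
  -- the data: `P = π ⊗ lam`, `Q = P^∨ ⊗ κ`, `τ₀ = 1`, `τ₁ = θ⁻¹`, `τν = ν`
  haveI : NeZero (3 : ℕ) := ⟨by norm_num⟩
  obtain ⟨P, hP⟩ := CuspidalAutomorphicRepData.exists_twist_hecke_hasSatakeParamAt lam π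
  obtain ⟨P', hP'⟩ := hC P
  set κ : HeckeCharacter F := θ⁻¹ * θ⁻¹ * (lam ^ 3 * Ω) with hκdef
  obtain ⟨Q, hQ⟩ := CuspidalAutomorphicRepData.exists_twist_hecke_hasSatakeParamAt κ P'
  set ν : HeckeCharacter F := κ * θ⁻¹ with hνdef
  obtain ⟨τ₀, hτ₀⟩ := exists_cuspidal_glOne_hasSatakeParamAt_one h1
  obtain ⟨τ₁, hτ₁⟩ := exists_cuspidal_glOne_hasSatakeParamAt_valueAtUniformizer h1 θ⁻¹
  obtain ⟨τν, hτν⟩ := exists_cuspidal_glOne_hasSatakeParamAt_valueAtUniformizer h1 ν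
  -- a Satake family of `π` and the good places
  obtain ⟨απ, eπ⟩ := exists_satakeFamily_of π.1
  have hgood : ∀ᶠ w : HeightOneSpectrum (𝓞 F) in cofinite,
      π.1.HasSatakeParamAt w (απ w) ∧ Ω.valueAtUniformizer w = (απ w).prod ∧
      μ.valueAtUniformizer w ∈ απ w ∧ ‖(απ w).prod‖ = ‖μ.valueAtUniformizer w‖ ^ 3 ∧
      P.1.HasSatakeParamAt w ((απ w).map (lam.valueAtUniformizer w * ·)) ∧
      Q.1.HasSatakeParamAt w
        ((((απ w).map (lam.valueAtUniformizer w * ·)).map (·⁻¹)).map (κ.valueAtUniformizer w * ·)) ∧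
      τ₀.1.HasSatakeParamAt w {1} ∧ τ₁.1.HasSatakeParamAt w {θ⁻¹.valueAtUniformizer w} ∧
      τν.1.HasSatakeParamAt w {ν.valueAtUniformizer w} := by
    filter_upwards [eπ, hΩ, hμ, hpin, hP, hQ, hτ₀, hτ₁, hτν]
      with w hw hΩw hμw hpw hPw hQw h0w h1w hνw
    exact ⟨hw, hΩw _ hw, hμw _ hw, hpw _ hw, hPw _ hw, hQw _ (hP' w _ (hPw _ hw)), h0w, h1w, hνw⟩
  obtain ⟨T, hT, hgoodT⟩ : ∃ T : Set (HeightOneSpectrum (𝓞 F)), T.Finite ∧ ∀ w ∉ T,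
      π.1.HasSatakeParamAt w (απ w) ∧ Ω.valueAtUniformizer w = (απ w).prod ∧
      μ.valueAtUniformizer w ∈ απ w ∧ ‖(απ w).prod‖ = ‖μ.valueAtUniformizer w‖ ^ 3 ∧
      P.1.HasSatakeParamAt w ((απ w).map (lam.valueAtUniformizer w * ·)) ∧
      Q.1.HasSatakeParamAt w
        ((((απ w).map (lam.valueAtUniformizer w * ·)).map (·⁻¹)).map (κ.valueAtUniformizer w * ·)) ∧
      τ₀.1.HasSatakeParamAt w {1} ∧ τ₁.1.HasSatakeParamAt w {θ⁻¹.valueAtUniformizer w} ∧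
      τν.1.HasSatakeParamAt w {ν.valueAtUniformizer w} :=
    ⟨_, Filter.eventually_cofinite.1 hgood, fun w hw => not_not.1 hw⟩
  -- notation for the families
  set β : SatakeFamily F := fun w => (απ w).map (lam.valueAtUniformizer w * ·) with hβdef
  set B : SatakeFamily F := fun w => ((β w).map (·⁻¹)).map (κ.valueAtUniformizer w * ·) with hBdef
  -- pointwise facts at a good place
  have card3 : ∀ w ∉ T, Multiset.card (απ w) = 3 := fun w hw => (hgoodT w hw).1.card_eq
  have hθmem : ∀ w ∉ T, θ.valueAtUniformizer w ∈ β w := fun w hw => by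
    rw [hθdef, bh_vAU_mul, hβdef]
    exact Multiset.mem_map_of_mem _ (hgoodT w hw).2.2.1
  have hβ0 : ∀ w ∉ T, (0 : ℂ) ∉ β w := fun w hw h0 =>
    hasSatakeParamAt_ne_zero_holds (hgoodT w hw).2.2.2.2.1 0 h0 rfl
  have hβprod : ∀ w ∉ T, (β w).prod = lam.valueAtUniformizer w ^ 3 * Ω.valueAtUniformizer w :=
    fun w hw => by
    show ((απ w).map (lam.valueAtUniformizer w * ·)).prod = _
    rw [prod_map_const_mul_eq, card3 w hw, (hgoodT w hw).2.1]
  have hnβ : ∀ w ∉ T, ‖(β w).prod‖ = 1 := fun w hw => by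
    rw [hβprod w hw, norm_mul, norm_pow, (hgoodT w hw).2.1, (hgoodT w hw).2.2.2.1, ← mul_pow,
      bh_vAU_apply, bh_vAU_apply, hθu, one_pow]
  have hκ : ∀ w ∉ T, κ.valueAtUniformizer w =
      (θ.valueAtUniformizer w)⁻¹ * (θ.valueAtUniformizer w)⁻¹ * (β w).prod := fun w hw => by
    rw [hκdef, bh_vAU_mul, bh_vAU_mul, bh_vAU_mul, bh_vAU_inv, bh_vAU_pow, hβprod w hw]
  have hnκ : ∀ w ∉ T, ‖κ.valueAtUniformizer w‖ = 1 := fun w hw => by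
    rw [hκ w hw, norm_mul, norm_mul, norm_inv, hθ1, hnβ w hw, inv_one, one_mul, one_mul]
  have hν : ∀ w, ν.valueAtUniformizer w = κ.valueAtUniformizer w * (θ.valueAtUniformizer w)⁻¹ :=
    fun w => by rw [hνdef, bh_vAU_mul, bh_vAU_inv]
  have hnν : ∀ w ∉ T, ‖ν.valueAtUniformizer w‖ = 1 := fun w hw => by
    rw [hν, norm_mul, norm_inv, hnκ w hw, hθ1, inv_one, one_mul]
  have hnB : ∀ w ∉ T, ‖(B w).prod‖ = 1 := fun w hw => by
    show ‖(((β w).map (·⁻¹)).map (κ.valueAtUniformizer w * ·)).prod‖ = 1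
    rw [prod_map_const_mul_eq, Multiset.prod_map_inv, Multiset.map_id', norm_mul, norm_pow, norm_inv,
      hnκ w hw, hnβ w hw, one_pow, inv_one, one_mul]
  -- the Euler-factor identity at a good place
  have hId : ∀ w ∉ T,
      satakePairPolynomial (β w) {θ⁻¹.valueAtUniformizer w} *
          satakePairPolynomial {ν.valueAtUniformizer w} {1} =
        satakePairPolynomial {1} {1} * satakePairPolynomial (B w) {1} := by
    intro w hw
    obtain ⟨γ, hγ⟩ := Multiset.exists_cons_of_mem (hθmem w hw)
    have hcardβ : Multiset.card (β w) = 3 := by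
      show Multiset.card ((απ w).map (lam.valueAtUniformizer w * ·)) = 3
      rw [Multiset.card_map, card3 w hw]
    have hcardγ : Multiset.card γ = 2 := by
      rw [hγ, Multiset.card_cons] at hcardβ
      omega
    obtain ⟨b, c, rfl⟩ := Multiset.card_eq_two.1 hcardγ
    have hθ0 : θ.valueAtUniformizer w ≠ 0 := bh_vAU_ne_zero θ w
    have hb : b ≠ 0 := fun h => hβ0 w hw (by rw [hγ, h]; simp)
    have hc : c ≠ 0 := fun h => hβ0 w hw (by rw [hγ, h]; simp)
    have hprodγ : (β w).prod = θ.valueAtUniformizer w * (b * c) := by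
      rw [hγ, Multiset.prod_cons, Multiset.insert_eq_cons, Multiset.prod_cons, Multiset.prod_singleton]
    have hκw : κ.valueAtUniformizer w = (θ.valueAtUniformizer w)⁻¹ * (b * c) := by
      rw [hκ w hw, hprodγ, mul_assoc, inv_mul_cancel_left₀ hθ0]
    have hνw : ν.valueAtUniformizer w =
        (θ.valueAtUniformizer w)⁻¹ * (b * c) * (θ.valueAtUniformizer w)⁻¹ := by
      rw [hν, hκw]
    have hBw : B w = ((β w).map (·⁻¹)).map ((θ.valueAtUniformizer w)⁻¹ * (b * c) * ·) := by
      show ((β w).map (·⁻¹)).map (κ.valueAtUniformizer w * ·) = _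
      rw [hκw]
    rw [hBw, hγ, bh_vAU_inv, hνw]
    exact satakePairPolynomial_bh_identity hθ0 hb hc
  -- the analytic core: `ν(ϖ_w) = 1` for almost all `w`
  have hX := eventually_eq_one_of_JS_of_eulerIdentity hJ2 τ₀ τ₁ τν P Q (fun _ => {1})
    (fun w => {θ⁻¹.valueAtUniformizer w}) (fun w => {ν.valueAtUniformizer w}) β B hT (fun _ => rfl)
    (fun w hw => (hgoodT w hw).2.2.2.2.2.2.1) (fun w hw => (hgoodT w hw).2.2.2.2.2.2.2.1)
    (fun w hw => (hgoodT w hw).2.2.2.2.2.2.2.2) (fun w hw => (hgoodT w hw).2.2.2.2.1)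
    (fun w hw => (hgoodT w hw).2.2.2.2.2.1)
    (fun w hw => by rw [Multiset.prod_singleton, bh_vAU_inv, norm_inv, hθ1, inv_one])
    (fun w hw => by rw [Multiset.prod_singleton, hnν w hw]) hnβ hnB hId
  -- conclusion: `∏ α_w = μ(ϖ_w)³`
  filter_upwards [hX, hT.eventually_cofinite_notMem] with w hXw hw α hα
  have e1 : ν.valueAtUniformizer w = 1 := by
    simpa [sub_self, Complex.cpow_zero] using hXw
  have hαe : α = απ w := π.1.hasSatakeParamAt_unique_holds hα (hgoodT w hw).1
  have hθw : θ.valueAtUniformizer w = lam.valueAtUniformizer w * μ.valueAtUniformizer w := by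
    rw [hθdef, bh_vAU_mul]
  have hlam0 : lam.valueAtUniformizer w ≠ 0 := bh_vAU_ne_zero lam w
  have hθ0 : θ.valueAtUniformizer w ≠ 0 := bh_vAU_ne_zero θ w
  rw [hν, hκ w hw, hβprod w hw, (hgoodT w hw).2.1] at e1
  -- `e1 : θ⁻¹ θ⁻¹ (lam³ ∏απ) θ⁻¹ = 1`
  rw [hαe]
  have e2 : lam.valueAtUniformizer w ^ 3 * (απ w).prod = θ.valueAtUniformizer w ^ 3 := by
    field_simp at e1
    linear_combination e1
  rw [hθw, mul_pow] at e2
  exact mul_left_cancel₀ (pow_ne_zero 3 hlam0) e2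

end Construction


/-! ### Assembly: `hB` of the reduction file from Jacquet–Shalika, the contragredient, central
characters and the weight condition; Theorem 1.2 from named facts of the tree and three printed
inputs -/

section Assembly

/-- **The analytic case `hB` of `lDichotomy_gl3_totallyReal_of_satakeLevel` from Jacquet–Shalika
(2.2), the contragredient, central characters at Satake level, and the weight condition.**
Granting, for every number field: Jacquet–Shalika (2.2) for Borel–Jacquet data
(`JacquetShalika1981_partialPairL_boundary_repData` of `PairLFunctionPolesRepData`; (2.1) is the theorem
`JacquetShalika1981_multipliable_partialPairL_repData_holds` and the only instance of (2.3) used, the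
pole of `ζ_K^S`, is the theorem `tendsto_sub_one_mul_partialPairL_one_one`), the contragredient datum
on `GL_3`
(`CuspidalAutomorphicRepData.exists_contragredient_satake`), a central character at Satake level for
every cuspidal `π` on `GL_3` (`hcent`: `Ω(ϖ_v) = ∏ α_v` a.e.; Borel–Jacquet 1979, 5.7 — supplied from
the Borel–Jacquet dictionary leaves by `exists_heckeCharacter_prod_satake_of_sSup_irreducible`), and
the weight condition (`hpin`: for `K` totally real, `π` regular algebraic cuspidal on `GL_3` and an
algebraic `μ` with `μ(ϖ_v) ∈ α_v` a.e., `‖∏ α_v‖ = ‖μ(ϖ_v)‖³` a.e. — the purity bookkeeping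
implicit in the printed "non-zero at `s = 1` by Shahidi [Sh97]"), the statement `hB` holds, by
`prod_satake_eq_cube_of_JS`. [cite: BockleHui2025, §3.2.1] -/
theorem satakeLevel_analyticCase_of_JS
    (hJ2 : JacquetShalika1981_partialPairL_boundary_repData)
    (hC : ∀ (K : Type) [Field K] [NumberField K] (hcpt : isCompact_glFiniteIntegralLevel 3 K),
      CuspidalAutomorphicRepData.exists_contragredient_satake hcpt)
    (hcent : ∀ (K : Type) [Field K] [NumberField K] (hcpt : isCompact_glFiniteIntegralLevel 3 K)
      (π : CuspidalAutomorphicRepData 3 K hcpt),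
      ∃ Ω : HeckeCharacter K, ∀ᶠ v : HeightOneSpectrum (𝓞 K) in cofinite, ∀ α : Multiset ℂ,
        π.1.HasSatakeParamAt v α → Ω.valueAtUniformizer v = α.prod)
    (hpin : ∀ (K : Type) [Field K] [NumberField K], IsTotallyReal K →
      ∀ (hcpt : isCompact_glFiniteIntegralLevel 3 K) (π : CuspidalAutomorphicRepData 3 K hcpt),
        π.1.IsRegularAlgebraic → ∀ μ : HeckeCharacter K, μ.IsAlgebraic →
        (∀ᶠ v : HeightOneSpectrum (𝓞 K) in cofinite, μ.IsUnramifiedAt v ∧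
          ∀ α : Multiset ℂ, π.1.HasSatakeParamAt v α → μ.valueAtUniformizer v ∈ α) →
        ∀ᶠ v : HeightOneSpectrum (𝓞 K) in cofinite,
          ∀ α : Multiset ℂ, π.1.HasSatakeParamAt v α → ‖α.prod‖ = ‖μ.valueAtUniformizer v‖ ^ 3) :
    ∀ (K : Type) [Field K] [NumberField K], IsTotallyReal K →
      ∀ (hcpt : isCompact_glFiniteIntegralLevel 3 K) (π : CuspidalAutomorphicRepData 3 K hcpt),
        π.1.IsRegularAlgebraic → ∀ μ : HeckeCharacter K, μ.IsAlgebraic →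
        (∀ᶠ v : HeightOneSpectrum (𝓞 K) in cofinite, μ.IsUnramifiedAt v ∧
          ∀ α : Multiset ℂ, π.1.HasSatakeParamAt v α → μ.valueAtUniformizer v ∈ α) →
        ∀ᶠ v : HeightOneSpectrum (𝓞 K) in cofinite,
          ∀ α : Multiset ℂ, π.1.HasSatakeParamAt v α → α.prod = μ.valueAtUniformizer v ^ 3 := by
  intro K _ _ hK hcpt π hπ μ hμalg hμ
  obtain ⟨Ω, hΩ⟩ := hcent K hcpt π
  exact prod_satake_eq_cube_of_JS hJ2 (hC K hcpt) π hΩ (hμ.mono fun v hv => hv.2)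
    (hpin K hK hcpt π hπ μ hμalg hμ)

/-- **Central characters at Satake level from the Borel–Jacquet dictionary leaves** (the input
`hcent` of `satakeLevel_analyticCase_of_JS`): for every cuspidal `π` on `GL_3(𝔸_K)` there is a Hecke
character `Ω` with `Ω(ϖ_v) = ∏ α_v` at almost all `v`, granting `AutomorphicRepsGL.exists_isAssociatedL2`,
`hasSatakeParamAt_iff_L2` and `AutomorphicRepsGL.stable_cuspidal_eq_sSup_irreducible`
(`exists_heckeCharacter_prod_satake_of_sSup_irreducible`, with the automorphic measure of
`AdelicGroupData.exists_isAutomorphicMeasure_gl_holds`).  Borel–Jacquet 1979, §4.6 and 5.7.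
[cite: BorelJacquetCorvallis1979, §4.6 and 5.7] -/
theorem centralCharacter_satake_gl3_of_leaves
    (hAss : ∀ (K : Type) [Field K] [NumberField K] (hcpt : isCompact_glFiniteIntegralLevel 3 K)
      (μ : Measure (gl 3 K).automorphicQuotient) [(gl 3 K).IsAutomorphicMeasure μ],
      AutomorphicRepsGL.exists_isAssociatedL2 hcpt μ)
    (hL2 : ∀ (K : Type) [Field K] [NumberField K] (hcpt : isCompact_glFiniteIntegralLevel 3 K)
      (μ : Measure (gl 3 K).automorphicQuotient) [(gl 3 K).IsAutomorphicMeasure μ],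
      hasSatakeParamAt_iff_L2 hcpt μ)
    (hss : ∀ (K : Type) [Field K] [NumberField K] (hcpt : isCompact_glFiniteIntegralLevel 3 K),
      AutomorphicRepsGL.stable_cuspidal_eq_sSup_irreducible hcpt) :
    ∀ (K : Type) [Field K] [NumberField K] (hcpt : isCompact_glFiniteIntegralLevel 3 K)
      (π : CuspidalAutomorphicRepData 3 K hcpt),
      ∃ Ω : HeckeCharacter K, ∀ᶠ v : HeightOneSpectrum (𝓞 K) in cofinite, ∀ α : Multiset ℂ,
        π.1.HasSatakeParamAt v α → Ω.valueAtUniformizer v = α.prod := by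
  intro K _ _ hcpt π
  obtain ⟨μ, hμ⟩ := AdelicGroupData.exists_isAutomorphicMeasure_gl_holds 3 K
  haveI := hμ
  haveI : NeZero (3 : ℕ) := ⟨by norm_num⟩
  exact exists_heckeCharacter_prod_satake_of_sSup_irreducible (hAss K hcpt μ) (hL2 K hcpt μ)
    (hss K hcpt) π

/-- **Böckle–Hui, Theorem 1.2, from named facts of the tree and three printed inputs.**  What now
separates `isIrreducible_galoisRep_gl3_totallyReal_holds` from the tree:
* named facts, unproved: Böckle–Hui Thm. 1.1 (`exists_heckeCharacter_of_weaklyDivides`),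
  Jacquet–Shalika (2.2) for Borel–Jacquet data (`JacquetShalika1981_partialPairL_boundary_repData`;
  (2.1) and the pole of `ζ_K^S` — all of (2.3) that is used — are theorems), the
  contragredient datum (`CuspidalAutomorphicRepData.exists_contragredient_satake`), and the
  Borel–Jacquet dictionary leaves behind `hcent` (`centralCharacter_satake_gl3_of_leaves`);
* printed inputs with no carrier in the tree: C-arithmeticity of `π` (`hCar`, Clozel 3.13 + BG14),
  the weight condition `hpin` (purity: `K` totally real, `n = 3`), and [Hu23a] (`hHui`).
The proof is `isIrreducible_galoisRep_gl3_totallyReal_of_weaklyDivides_of_arithmetic_of_satakeLevel_of_hui`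
with `hB := satakeLevel_analyticCase_of_JS`. [cite: BockleHui2025, Theorem 1.2, §3.1 and §3.2.1] -/
theorem isIrreducible_galoisRep_gl3_totallyReal_of_JS
    (hBH : GaloisRepresentations.exists_heckeCharacter_of_weaklyDivides)
    (hCar : ∀ {K : Type} [Field K] [NumberField K] (hcpt : isCompact_glFiniteIntegralLevel 3 K),
      IsTotallyReal K → ∀ (π : CuspidalAutomorphicRepData 3 K hcpt), π.1.IsRegularAlgebraic →
      ∃ E : Subfield ℂ, FiniteDimensional ℚ E ∧
        ∀ᶠ v : HeightOneSpectrum (𝓞 K) in cofinite, ∀ α : Multiset ℂ,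
          π.1.HasSatakeParamAt v α → ∀ i ≤ 3, heckeEigenvalueOf 3 v α i ∈ E)
    (hJ2 : JacquetShalika1981_partialPairL_boundary_repData)
    (hC : ∀ (K : Type) [Field K] [NumberField K] (hcpt : isCompact_glFiniteIntegralLevel 3 K),
      CuspidalAutomorphicRepData.exists_contragredient_satake hcpt)
    (hcent : ∀ (K : Type) [Field K] [NumberField K] (hcpt : isCompact_glFiniteIntegralLevel 3 K)
      (π : CuspidalAutomorphicRepData 3 K hcpt),
      ∃ Ω : HeckeCharacter K, ∀ᶠ v : HeightOneSpectrum (𝓞 K) in cofinite, ∀ α : Multiset ℂ,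
        π.1.HasSatakeParamAt v α → Ω.valueAtUniformizer v = α.prod)
    (hpin : ∀ (K : Type) [Field K] [NumberField K], IsTotallyReal K →
      ∀ (hcpt : isCompact_glFiniteIntegralLevel 3 K) (π : CuspidalAutomorphicRepData 3 K hcpt),
        π.1.IsRegularAlgebraic → ∀ μ : HeckeCharacter K, μ.IsAlgebraic →
        (∀ᶠ v : HeightOneSpectrum (𝓞 K) in cofinite, μ.IsUnramifiedAt v ∧
          ∀ α : Multiset ℂ, π.1.HasSatakeParamAt v α → μ.valueAtUniformizer v ∈ α) →
        ∀ᶠ v : HeightOneSpectrum (𝓞 K) in cofinite,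
          ∀ α : Multiset ℂ, π.1.HasSatakeParamAt v α → ‖α.prod‖ = ‖μ.valueAtUniformizer v‖ ^ 3)
    (hHui : ∀ (K : Type) [Field K] [NumberField K], IsTotallyReal K →
      ∀ (hcpt : isCompact_glFiniteIntegralLevel 3 K) (π : CuspidalAutomorphicRepData 3 K hcpt),
        π.1.IsRegularAlgebraic →
        (∃ η : HeckeCharacter K, ∀ᶠ v : HeightOneSpectrum (𝓞 K) in cofinite,
          ∀ α : Multiset ℂ, π.1.HasSatakeParamAt v α →
            η.IsUnramifiedAt v ∧ α.map (fun a => a⁻¹) = α.map (fun a => η.valueAtUniformizer v * a)) →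
        ∀ (ℓ : ℕ) [Fact ℓ.Prime] (ι : PadicAlgCl ℓ ≃+* ℂ)
        (r : GaloisRepresentations.FramedGaloisRep K (PadicAlgCl ℓ) 3), r.toGaloisRep.IsSemisimple →
        (∀ (v : HeightOneSpectrum (𝓞 K)) (α : Multiset ℂ), π.1.HasSatakeParamAt v α →
            ((ℓ : ℕ) : 𝓞 K) ∉ v.asIdeal →
              r.IsUnramifiedAt v ∧ r.HasFrobCharpolyAt v (arithFrobPolyOfSatake ι v.residueCard 3 α)) →
        r.toGaloisRep.IsIrreducible) :
    isIrreducible_galoisRep_gl3_totallyReal :=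
  isIrreducible_galoisRep_gl3_totallyReal_of_weaklyDivides_of_arithmetic_of_satakeLevel_of_hui hBH
    hCar (satakeLevel_analyticCase_of_JS hJ2 hC hcent hpin) hHui

end Assembly

end Literature.NumberTheory.Automorphic
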